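import Summits.CriticalPhenomena.PercolationContinuityZ3.Theorems.PercNearOneGluingNoHeavyLowerTailThreePointProductFormTreeRecursion
import HarnessLib

/-!
# The product form (P) for the SCALED tree recursion (Sahi programme, prover prim-sahi-p2 gen 59)

Support file (`--supports stmt-CriticalPhenomena-4575`, helper); generalises `…ThreePointProductFormTreeRecursion` (same gen) to the form in which the
recursion arises from normalised fibre counts: at each vertex a positive scale `κ_v` (from reading the pieces' labels as closed elsewhere) and mark
factors `fA_v, fB_v` (`= 1` without a mark, `≥ 2` with `k ≥ 1` parallel mark labels, namely `2^k`).  Standard axioms, no sorries, no named facts, no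
definitions.  Memo `run/shared/lean/prim/prim-sahi/FROM-prim-sahi-p2-gen59-ONE-STEP-LEMMA.md` §2, §8(2); `prim-sahi-p2/PROOF-E3.md` (68j), §69.
* `productForm_of_treeRecursion_scaled` — `r_v = κ_v ∏(p_u+q_u)`, `p_v = κ_v fA_v ∏(2p_u+q_u−r_u)`, `q_v = κ_v fB_v ∏(p_u+2q_u−r_u)`,
  `g_v = κ_v·(gen-58 good-recursion)` ⟹ at every vertex `0 ≤ r ≤ p`, `r ≤ q`, `0 ≤ g`, `(r − g)² ≤ (p − r)(q − r)`.
[this work] (gen 59).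
-/

namespace Summit.CriticalPhenomena.PercolationContinuityZ3.Theorems.ProductFormOneStep

open Finset

section Tree

variable {V : Type*} [DecidableEq V]

/-- **(P) at every vertex of the scaled tree recursion.** [this work] -/
theorem productForm_of_treeRecursion_scaled (ch : V → Finset V) (ht : V → ℕ) (hht : ∀ v, ∀ u ∈ ch v, ht u < ht v)
    (mA mB : V → Bool) (κ fA fB r p q g : V → ℝ) (hκ : ∀ v, 0 < κ v)
    (hfA1 : ∀ v, mA v = false → fA v = 1) (hfA2 : ∀ v, mA v = true → 2 ≤ fA v)
    (hfB1 : ∀ v, mB v = false → fB v = 1) (hfB2 : ∀ v, mB v = true → 2 ≤ fB v)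
    (hr : ∀ v, r v = κ v * ∏ u ∈ ch v, (p u + q u))
    (hp : ∀ v, p v = κ v * fA v * ∏ u ∈ ch v, (2 * p u + q u - r u))
    (hq : ∀ v, q v = κ v * fB v * ∏ u ∈ ch v, (p u + 2 * q u - r u))
    (hg : ∀ v, g v = κ v * (if mA v then (if mB v then 0 else ∏ u ∈ ch v, (p u + g u))
      else (if mB v then ∏ u ∈ ch v, (q u + g u)
        else (∏ u ∈ ch v, (p u + g u)) + (∏ u ∈ ch v, (q u + g u)) - ∏ u ∈ ch v, (r u + g u))))
    (v : V) :
    0 ≤ r v ∧ r v ≤ p v ∧ r v ≤ q v ∧ 0 ≤ g v ∧ (r v - g v) ^ 2 ≤ (p v - r v) * (q v - r v) := by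
  suffices H : ∀ N : ℕ, ∀ v, ht v ≤ N →
      0 ≤ r v ∧ r v ≤ p v ∧ r v ≤ q v ∧ 0 ≤ g v ∧ (r v - g v) ^ 2 ≤ (p v - r v) * (q v - r v) from H (ht v) v le_rfl
  intro N
  induction N using Nat.strong_induction_on with
  | _ N ih =>
    intro v hv
    have IH : ∀ u ∈ ch v, 0 ≤ r u ∧ r u ≤ p u ∧ r u ≤ q u ∧ 0 ≤ g u ∧ (r u - g u) ^ 2 ≤ (p u - r u) * (q u - r u) :=
      fun u hu => ih (ht u) (by have := hht v u hu; omega) u le_rfl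
    have hrp : ∀ u ∈ ch v, r u ≤ p u := fun u hu => (IH u hu).2.1
    have hrq : ∀ u ∈ ch v, r u ≤ q u := fun u hu => (IH u hu).2.2.1
    have hgu : ∀ u ∈ ch v, 0 ≤ g u := fun u hu => (IH u hu).2.2.2.1
    have hPu : ∀ u ∈ ch v, (r u - g u) ^ 2 ≤ (p u - r u) * (q u - r u) := fun u hu => (IH u hu).2.2.2.2
    have hr0 : ∀ u ∈ ch v, 0 ≤ r u := fun u hu => (IH u hu).1
    have hσ0 : 0 ≤ ∏ u ∈ ch v, (p u + q u) :=
      Finset.prod_nonneg fun u hu => by linarith [hr0 u hu, hrp u hu, hrq u hu]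
    have hσA : ∏ u ∈ ch v, (p u + q u) ≤ ∏ u ∈ ch v, (2 * p u + q u - r u) :=
      Finset.prod_le_prod (fun u hu => by linarith [hr0 u hu, hrp u hu, hrq u hu]) (fun u hu => by linarith [hrp u hu])
    have hσB : ∏ u ∈ ch v, (p u + q u) ≤ ∏ u ∈ ch v, (p u + 2 * q u - r u) :=
      Finset.prod_le_prod (fun u hu => by linarith [hr0 u hu, hrp u hu, hrq u hu]) (fun u hu => by linarith [hrq u hu])
    have hA0 : 0 ≤ ∏ u ∈ ch v, (2 * p u + q u - r u) := hσ0.trans hσA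
    have hB0 : 0 ≤ ∏ u ∈ ch v, (p u + 2 * q u - r u) := hσ0.trans hσB
    have hPG0 : 0 ≤ ∏ u ∈ ch v, (p u + g u) :=
      Finset.prod_nonneg fun u hu => by linarith [hr0 u hu, hrp u hu, hgu u hu]
    have hQG0 : 0 ≤ ∏ u ∈ ch v, (q u + g u) :=
      Finset.prod_nonneg fun u hu => by linarith [hr0 u hu, hrq u hu, hgu u hu]
    have hRGQG : ∏ u ∈ ch v, (r u + g u) ≤ ∏ u ∈ ch v, (q u + g u) :=
      Finset.prod_le_prod (fun u hu => by linarith [hr0 u hu, hgu u hu]) (fun u hu => by linarith [hrq u hu])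
    have h1 := oneStep_tree (ch v) r p q g hrp hrq hgu hPu
    have h2 := oneStep_tree_marked (ch v) r p q g hrp hrq hgu hPu
    have h3 := oneStep_tree_marked' (ch v) r p q g hrp hrq hgu hPu
    have hr' := hr v; have hp' := hp v; have hq' := hq v; have hg' := hg v
    have hk := hκ v
    set K := κ v with hK
    set S := ∏ u ∈ ch v, (p u + q u) with hS
    set PA := ∏ u ∈ ch v, (2 * p u + q u - r u) with hPA
    set PB := ∏ u ∈ ch v, (p u + 2 * q u - r u) with hPB
    set PG := ∏ u ∈ ch v, (p u + g u) with hPG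
    set QG := ∏ u ∈ ch v, (q u + g u) with hQG
    set RG := ∏ u ∈ ch v, (r u + g u) with hRG
    -- the mark factors
    have hfA : 1 ≤ fA v := by
      cases h : mA v
      · rw [hfA1 v h]
      · linarith only [hfA2 v h]
    have hfB : 1 ≤ fB v := by
      cases h : mB v
      · rw [hfB1 v h]
      · linarith only [hfB2 v h]
    have hA1 : 0 ≤ (fA v - 1) * PA := mul_nonneg (by linarith only [hfA]) hA0
    have hB1 : 0 ≤ (fB v - 1) * PB := mul_nonneg (by linarith only [hfB]) hB0
    have hSA : S ≤ fA v * PA := by nlinarith only [hA1, hσA]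
    have hSB : S ≤ fB v * PB := by nlinarith only [hB1, hσB]
    refine ⟨by rw [hr']; exact mul_nonneg hk.le hσ0, ?_, ?_, ?_, ?_⟩
    · rw [hr', hp']
      calc K * S ≤ K * (fA v * PA) := mul_le_mul_of_nonneg_left hSA hk.le
        _ = K * fA v * PA := by ring
    · rw [hr', hq']
      calc K * S ≤ K * (fB v * PB) := mul_le_mul_of_nonneg_left hSB hk.le
        _ = K * fB v * PB := by ring
    · rw [hg']; refine mul_nonneg hk.le ?_; split_ifs <;> linarith only [hPG0, hQG0, hRGQG]
    · rw [hr', hp', hq', hg']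
      have hk2 : 0 ≤ K ^ 2 := sq_nonneg K
      cases hA : mA v <;> cases hB : mB v <;> simp only [Bool.false_eq_true, ↓reduceIte]
      · -- unmarked: fA = fB = 1
        rw [hfA1 v hA, hfB1 v hB]
        have e1 : (K * S - K * (PG + QG - RG)) ^ 2 = K ^ 2 * (S - QG - PG + RG) ^ 2 := by ring
        have e2 : (K * 1 * PA - K * S) * (K * 1 * PB - K * S) = K ^ 2 * ((PA - S) * (PB - S)) := by ring
        rw [e1, e2]
        exact mul_le_mul_of_nonneg_left h1 hk2
      · -- mB only
        rw [hfA1 v hA]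
        have hf2 := hfB2 v hB
        have e1 : (K * S - K * QG) ^ 2 = K ^ 2 * (S - QG) ^ 2 := by ring
        have e2 : (K * 1 * PA - K * S) * (K * fB v * PB - K * S) = K ^ 2 * ((PA - S) * (fB v * PB - S)) := by ring
        rw [e1, e2]
        refine mul_le_mul_of_nonneg_left ?_ hk2
        have h4 : 0 ≤ (fB v - 2) * PB := mul_nonneg (by linarith only [hf2]) hB0
        calc (S - QG) ^ 2 ≤ (PA - S) * PB := h3
          _ ≤ (PA - S) * (fB v * PB - S) := by
              apply mul_le_mul_of_nonneg_left _ (by linarith only [hσA])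
              nlinarith only [h4, hσB]
      · -- mA only
        rw [hfB1 v hB]
        have hf2 := hfA2 v hA
        have e1 : (K * S - K * PG) ^ 2 = K ^ 2 * (S - PG) ^ 2 := by ring
        have e2 : (K * fA v * PA - K * S) * (K * 1 * PB - K * S) = K ^ 2 * ((fA v * PA - S) * (PB - S)) := by ring
        rw [e1, e2]
        refine mul_le_mul_of_nonneg_left ?_ hk2
        have h4 : 0 ≤ (fA v - 2) * PA := mul_nonneg (by linarith only [hf2]) hA0
        calc (S - PG) ^ 2 ≤ PA * (PB - S) := h2
          _ ≤ (fA v * PA - S) * (PB - S) := by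
              apply mul_le_mul_of_nonneg_right _ (by linarith only [hσB])
              nlinarith only [h4, hσA]
      · -- both
        have hf2 := hfA2 v hA; have hf3 := hfB2 v hB
        have e1 : (K * S - K * 0) ^ 2 = K ^ 2 * (S * S) := by ring
        have e2 : (K * fA v * PA - K * S) * (K * fB v * PB - K * S) = K ^ 2 * ((fA v * PA - S) * (fB v * PB - S)) := by ring
        rw [e1, e2]
        refine mul_le_mul_of_nonneg_left ?_ hk2
        have h4 : 0 ≤ (fA v - 2) * PA := mul_nonneg (by linarith only [hf2]) hA0
        have h5 : 0 ≤ (fB v - 2) * PB := mul_nonneg (by linarith only [hf3]) hB0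
        have h6 : S ≤ fA v * PA - S := by nlinarith only [h4, hσA]
        have h7 : S ≤ fB v * PB - S := by nlinarith only [h5, hσB]
        exact mul_le_mul h6 h7 hσ0 (hσ0.trans h6)

end Tree

end Summit.CriticalPhenomena.PercolationContinuityZ3.Theorems.ProductFormOneStep
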